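import Literature.NumberTheory.Automorphic.UmgTwistInvariantModule
import Literature.NumberTheory.Automorphic.AutomorphicTwistNorm
import HarnessLib

/-!
# The pairing of the moderate-growth module `W'_T` against the cusp forms of `π`, and its
# skew-adjointness along trace-zero Lie derivatives

Topic `NumberTheory/Automorphic`; namespace
`Literature.NumberTheory.Automorphic.AutomorphicRepData.UnitaryTwist`.  Definitions with bodies and
theorems; no named fact, no `sorry`.

The pairing `p` of Borel's injectivity of cuspidal cohomology
(`ResGLnKugaPairedPrimitive.false_of_horizontal_pairedPrimitive`,
`ResGLnCuspidalCohomologyReduction.coneClass_ne_zero_of_primitive`) on the concrete auxiliary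
module `W'_T = umgSpace T` of `UmgTwistInvariantModule`, for a cuspidal `π` (`W ≤ 𝒜₀`), `n ≠ 0`:

* `form' Φ = (|det|^s Φ)↓` on the automorphic quotient, `hasModerateGrowth_twist`,
  `integrable_conj_form'_mul_form` (moderate growth against a cusp form,
  `integrable_weight_mul_norm_of_isRapidlyDecreasingGL`);
* **`pairing μ Φ φ = ∫ conj (form' Φ) (form φ) dμ`**, sesquilinear (`pairing_add_left/smul_left/add_right/smul_right`),
  extending the Petersson form along `inclW` (`pairing_inclW`), and **skew along every `X ∈ 𝔤` of
  norm exponent `λ(X) = 0`** (`pairing_umgLieRep_left`: the twist commutes with such `X`, and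
  Borel's integration by parts of a function of moderate growth against a cusp form,
  `integral_descend_lieDeriv_mul_conj_cuspFormsGL_eq_neg`).

[cite: BorelWallach2000, II §2.2, XIV 2.3] [cite: Borel1997, 11.12 (2)]

## References

* A. Borel, N. Wallach (2000), II §2.2, XIV 2.3 (held). [BorelWallach2000]
* A. Borel, *Automorphic forms on SL₂(ℝ)* (1997), 11.12 (2). [Borel1997]
-/

noncomputable section

-- Mathlib idiom (Mathlib/Algebra/Lie/OfAssociative.lean), as in `ArchParameterTwistNorm`.
attribute [local instance 100] LieRing.ofAssociativeRing

open scoped Matrix ComplexConjugate Classical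
open Complex NumberField NumberField.mixedEmbedding NumberField.InfinitePlace IsDedekindDomain
open _root_.MeasureTheory _root_.MeasureTheory.Measure

namespace Literature.NumberTheory.Automorphic

namespace AutomorphicRepData

open Literature.NumberTheory.GaloisRepresentations (HeckeCharacter ideleGroup)

variable {n : ℕ} {K : Type} [Field K] [NumberField K] {hcpt : isCompact_glFiniteIntegralLevel n K}
  {π : AutomorphicRepData (AutomorphyDatum.gl n K hcpt)}

namespace UnitaryTwist

variable (T : UnitaryTwist π)

/-! ### The twisted element read on the quotient -/

/-- **`(|det|^s Φ)↓`** on `GL_n(𝔸_K) ⧸ A_G GL_n(K)` for `Φ ∈ W'_T`. [cite: BorelJacquetCorvallis1979, 4.2] -/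
def form' (Φ : T.umgSpace) : (AdelicGroupData.gl n K).automorphicQuotient → ℂ :=
  (AdelicGroupData.gl n K).descend (mulChar (detTwist n T.χ) (Φ : (AdelicGroupData.gl n K).Adelic → ℂ))
    (twist_inv_of_mem_umgSpace Φ.2)

/-- `invQuot (form' Φ) = |det|^s Φ`. [folklore] -/
@[simp] theorem invQuot_form' (Φ : T.umgSpace) :
    invQuot (AdelicGroupData.gl n K) (T.form' Φ) = mulChar (detTwist n T.χ) (Φ : (AdelicGroupData.gl n K).Adelic → ℂ) :=
  (AdelicGroupData.gl n K).invQuot_descend _ _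

/-- `form'` is additive. [folklore] -/
theorem form'_add (Φ Ψ : T.umgSpace) : T.form' (Φ + Ψ) = T.form' Φ + T.form' Ψ := by
  apply invQuot_injective
  rw [invQuot_form']
  change _ = invQuot (AdelicGroupData.gl n K) (T.form' Φ) + invQuot (AdelicGroupData.gl n K) (T.form' Ψ)
  rw [invQuot_form', invQuot_form', Submodule.coe_add, map_add]

/-- `form'` is homogeneous. [folklore] -/
theorem form'_smul (c : ℂ) (Φ : T.umgSpace) : T.form' (c • Φ) = c • T.form' Φ := by
  apply invQuot_injective
  rw [invQuot_form']
  change _ = c • invQuot (AdelicGroupData.gl n K) (T.form' Φ)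
  rw [invQuot_form', Submodule.coe_smul, map_smul]

/-- On the forms of `π`: `form' (inclW φ) = form φ`. [folklore] -/
theorem form'_inclW (φ : π.W) : T.form' (T.inclW φ) = T.form φ := by
  apply invQuot_injective
  rw [invQuot_form', invQuot_form, coe_inclW]

/-- `form' Φ` is continuous. [folklore] -/
theorem continuous_form' (Φ : T.umgSpace) : Continuous (T.form' Φ) := by
  refine continuous_of_continuous_invQuot ?_
  rw [invQuot_form']
  exact (Units.continuous_val.comp (continuous_detTwist (n := n) T.χ)).mul (continuous_of_mem_umgSpace Φ.2)

/-- **`|det|^s Φ` has moderate growth** for `Φ` of (uniform) moderate growth (`|det g|^{re s}` is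
polynomially bounded by the height). [cite: BorelJacquetCorvallis1979, §4.2] -/
theorem hasModerateGrowth_twist [NeZero n] {Φ : (AdelicGroupData.gl n K).Adelic → ℂ} (hΦ : Φ ∈ T.umgSpace) :
    HasModerateGrowth (AutomorphyDatum.gl n K hcpt) (mulChar (detTwist n T.χ) Φ) := by
  have hm : HasModerateGrowth (AutomorphyDatum.gl n K hcpt) Φ := by
    have h := (hasUniformModerateGrowth_of_mem_umgSpace hΦ).hasModerateGrowth_applyFree 1
    rwa [Literature.NumberTheory.Automorphic.applyFree_one] at h
  obtain ⟨C, r, hC⟩ := hm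
  obtain ⟨C', r', -, hC'⟩ := exists_ideleNorm_det_rpow_le_height (n := n) (K := K) T.s.re
  refine ⟨C' * C, r' + r, fun g => ?_⟩
  have h1 := hC' g
  have h2 := hC g
  rw [AutomorphyDatum.gl_height] at h2 ⊢
  have hN : 0 ≤ GaloisRepresentations.ideleNorm (Matrix.GeneralLinearGroup.det g) := by
    rw [← coe_ideleNorm]; exact NNReal.coe_nonneg _
  rw [mulChar_apply, norm_mul, norm_detTwist_of_cpow T.hχ, pow_add, mul_mul_mul_comm]
  exact mul_le_mul h1 h2 (norm_nonneg _) ((Real.rpow_nonneg hN _).trans h1)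

/-! ### Integrability of the pairing integrand -/

variable (μ : Measure (AdelicGroupData.gl n K).automorphicQuotient) [(AdelicGroupData.gl n K).IsAutomorphicMeasure μ]

/-- **Moderate growth against a cusp form is integrable on the automorphic quotient**:
`conj (form' Φ) · form φ ∈ L¹(μ)` (`π` cuspidal). [cite: MoeglinWaldspurger1995, I.2.2, I.2.18] -/
theorem integrable_conj_form'_mul_form [NeZero n] (Φ : T.umgSpace) (φ : π.W) :
    Integrable (fun q => conj (T.form' Φ q) * T.form φ q) μ := by
  have hn : 0 < n := Nat.pos_of_ne_zero (NeZero.ne n)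
  -- the weight `‖form' Φ‖` is continuous, of moderate growth along `GL_n(𝔸_K)`
  obtain ⟨C, r, hC⟩ := T.hasModerateGrowth_twist Φ.2
  have hwle : ∀ g : (AdelicGroupData.gl n K).Adelic,
      ‖T.form' Φ ((AdelicGroupData.gl n K).toAutomorphicQuotient g⁻¹)‖ ≤ C * (1 ⊔ adelicHeightGL n K g) ^ r := fun g => by
    have e : T.form' Φ ((AdelicGroupData.gl n K).toAutomorphicQuotient g⁻¹) = mulChar (detTwist n T.χ) (Φ : _ → ℂ) g := by
      rw [form', AdelicGroupData.descend_toAutomorphicQuotient, inv_inv]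
    rw [e]
    have h := hC g
    rwa [AutomorphyDatum.gl_height] at h
  -- the cusp form `|det|^s φ` is continuous and rapidly decreasing
  have hg : invQuot (AdelicGroupData.gl n K) (T.form φ) ∈ cuspFormsGL n K hcpt := T.invQuot_form_mem φ
  have hgc : Continuous (invQuot (AdelicGroupData.gl n K) (T.form φ)) :=
    continuous_of_mem_automorphicForms_gl (cuspFormsGL_le_automorphicForms n K hcpt hg)
  have hgA : ∀ z ∈ (AdelicGroupData.gl n K).center', ∀ x,
      invQuot (AdelicGroupData.gl n K) (T.form φ) (z * x) = invQuot (AdelicGroupData.gl n K) (T.form φ) x :=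
    fun _ hz x => invQuot_mul_left (AdelicGroupData.gl n K) _ ((AdelicGroupData.gl n K).center'_le_quotientSubgroup hz) x
  have hgrd : IsRapidlyDecreasingGL n K (invQuot (AdelicGroupData.gl n K) (T.form φ)) :=
    (isCuspFormGL_of_mem_cuspFormsGL' hg).isRapidlyDecreasingGL_of_center' hgA
  have hint := integrable_weight_mul_norm_of_isRapidlyDecreasingGL (μ := μ) hn
    ((T.continuous_form' Φ).norm) (fun y => norm_nonneg _) hwle hgc hgrd
  refine hint.mono' ?_ (Filter.Eventually.of_forall fun q => ?_)
  · exact ((Complex.continuous_conj.comp (T.continuous_form' Φ)).mul (T.continuous_form φ).1).aestronglyMeasurable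
  · rw [norm_mul, Complex.norm_conj]

/-! ### The pairing -/

/-- **The pairing `p(Φ, φ) = ∫ conj ((|det|^s Φ)↓) · (|det|^s φ)↓ dμ`** of `W'_T` against `W`.
[cite: BorelWallach2000, II §2.2] -/
def pairing (Φ : T.umgSpace) (φ : π.W) : ℂ :=
  ∫ q, conj (T.form' Φ q) * T.form φ q ∂μ

omit [(AdelicGroupData.gl n K).IsAutomorphicMeasure μ] in
/-- **The pairing extends the Petersson form**: `p(φ, ψ) = ⟪φ, ψ⟫` on `W`. [folklore] -/
theorem pairing_inclW (φ ψ : π.W) : T.pairing μ (T.inclW φ) ψ = T.pet μ φ ψ := by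
  simp only [pairing, pet, form'_inclW]

/-- The pairing is additive in the first variable. [folklore] -/
theorem pairing_add_left [NeZero n] (Φ Ψ : T.umgSpace) (φ : π.W) :
    T.pairing μ (Φ + Ψ) φ = T.pairing μ Φ φ + T.pairing μ Ψ φ := by
  simp only [pairing, form'_add, Pi.add_apply, map_add, add_mul]
  exact integral_add (T.integrable_conj_form'_mul_form μ Φ φ) (T.integrable_conj_form'_mul_form μ Ψ φ)

omit [(AdelicGroupData.gl n K).IsAutomorphicMeasure μ] in
/-- The pairing is conjugate-homogeneous in the first variable. [folklore] -/
theorem pairing_smul_left (c : ℂ) (Φ : T.umgSpace) (φ : π.W) :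
    T.pairing μ (c • Φ) φ = conj c * T.pairing μ Φ φ := by
  simp only [pairing, form'_smul, Pi.smul_apply, smul_eq_mul, map_mul, mul_assoc]
  exact integral_const_mul _ _

/-- The pairing is additive in the second variable. [folklore] -/
theorem pairing_add_right [NeZero n] (Φ : T.umgSpace) (φ ψ : π.W) :
    T.pairing μ Φ (φ + ψ) = T.pairing μ Φ φ + T.pairing μ Φ ψ := by
  simp only [pairing, form_add, Pi.add_apply, mul_add]
  exact integral_add (T.integrable_conj_form'_mul_form μ Φ φ) (T.integrable_conj_form'_mul_form μ Φ ψ)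

omit [(AdelicGroupData.gl n K).IsAutomorphicMeasure μ] in
/-- The pairing is homogeneous in the second variable. [folklore] -/
theorem pairing_smul_right (c : ℂ) (Φ : T.umgSpace) (φ : π.W) :
    T.pairing μ Φ (c • φ) = c * T.pairing μ Φ φ := by
  simp only [pairing, form_smul, Pi.smul_apply, smul_eq_mul, mul_left_comm _ c]
  exact integral_const_mul _ _

/-! ### Skew-adjointness along trace-zero Lie derivatives -/

/-- **Integration by parts across the pairing**: for `X ∈ 𝔤` of norm exponent
`λ(X) = Tr_{K_∞/ℝ} tr X = 0`, `p(X Φ, φ) = -p(Φ, X φ)` — the twist `|det|^s` commutes with such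
`X`, and Borel's lemma for a function of moderate growth against a cusp form.
[cite: Borel1997, 11.12 (2)] [cite: BorelWallach2000, II 2.2 (4)] -/
theorem pairing_umgLieRep_left [NeZero n] (X : (AutomorphyDatum.gl n K hcpt).arch.lie)
    (hX : ((∑ w, (X : Matrix (Fin n) (Fin n) (mixedSpace K)).trace.1 w) +
      ∑ w, 2 * ((X : Matrix (Fin n) (Fin n) (mixedSpace K)).trace.2 w).re) = 0)
    (Φ : T.umgSpace) (φ : π.W) :
    T.pairing μ (T.umgLieRep X Φ) φ = -T.pairing μ Φ (π.lieDerivW X φ) := by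
  have hn : 0 < n := Nat.pos_of_ne_zero (NeZero.ne n)
  obtain ⟨lam, -, hlam⟩ := exists_normExponent (n := n) (K := K) hcpt
  have hlamX : lam X = 0 := by rw [hlam, hX]
  haveI : FiniteDimensional ℝ (mixedSpace K) := inferInstance
  -- the twist commutes with `X` on both sides
  have hderΦ : lieDeriv (AutomorphyDatum.gl n K hcpt).ofArch X (mulChar (detTwist n T.χ) (Φ : _ → ℂ)) =
      mulChar (detTwist n T.χ) (lieDeriv (AutomorphyDatum.gl n K hcpt).ofArch X (Φ : _ → ℂ)) := by
    rw [lieDeriv_mulChar_of_exp _ (detTwist_ofArch_expMem_eq_exp_smul T.hχ hlam) X (isArchSmooth_of_mem_umgSpace Φ.2)]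
    change mulChar (detTwist n T.χ) (_ + ((T.s * (lam X : ℂ)) • (Φ : _ → ℂ))) = _
    rw [hlamX, Complex.ofReal_zero, mul_zero, zero_smul, add_zero]
  have hderφ : lieDeriv (AutomorphyDatum.gl n K hcpt).ofArch X (invQuot (AdelicGroupData.gl n K) (T.form φ)) =
      invQuot (AdelicGroupData.gl n K) (T.form (π.lieDerivW X φ)) := by
    rw [invQuot_form, invQuot_form, π.lieDeriv_mulChar_detTwist_of_cpow T.hχ hlam X φ, hlamX,
      Complex.ofReal_zero, mul_zero, zero_smul, add_zero]
  -- Borel's lemma for `|det|^s Φ` (moderate growth) against the cusp form `|det|^s φ`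
  have hΦinv := twist_inv_of_mem_umgSpace Φ.2
  have hΦm := T.hasModerateGrowth_twist Φ.2
  have hΦXm : HasModerateGrowth (AutomorphyDatum.gl n K hcpt)
      (lieDeriv (AutomorphyDatum.gl n K hcpt).ofArch X (mulChar (detTwist n T.χ) (Φ : _ → ℂ))) := by
    rw [hderΦ]; exact T.hasModerateGrowth_twist (lieDeriv_mem_umgSpace X Φ.2)
  have hcχ : Continuous fun g : (AdelicGroupData.gl n K).Adelic => ((detTwist n T.χ g : ℂˣ) : ℂ) :=
    Units.continuous_val.comp (continuous_detTwist (n := n) T.χ)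
  have hΦc : Continuous (mulChar (detTwist n T.χ) (Φ : _ → ℂ)) := hcχ.mul (continuous_of_mem_umgSpace Φ.2)
  have hΦXc : Continuous (lieDeriv (AutomorphyDatum.gl n K hcpt).ofArch X (mulChar (detTwist n T.χ) (Φ : _ → ℂ))) := by
    rw [hderΦ]; exact hcχ.mul (continuous_of_mem_umgSpace (lieDeriv_mem_umgSpace X Φ.2))
  have hΦs : IsArchSmooth (AutomorphyDatum.gl n K hcpt).ofArch (mulChar (detTwist n T.χ) (Φ : _ → ℂ)) :=
    isArchSmooth_mulChar_of_exp _ (detTwist_ofArch_expMem_eq_exp_smul T.hχ hlam) (isArchSmooth_of_mem_umgSpace Φ.2)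
  have hφ : mulChar (detTwist n T.χ) (φ : (AdelicGroupData.gl n K).Adelic → ℂ) ∈ cuspFormsGL n K hcpt := T.cusp φ φ.2
  have hφA : ∀ z ∈ (AdelicGroupData.gl n K).center', ∀ x,
      mulChar (detTwist n T.χ) (φ : (AdelicGroupData.gl n K).Adelic → ℂ) (z * x) =
        mulChar (detTwist n T.χ) (φ : (AdelicGroupData.gl n K).Adelic → ℂ) x :=
    fun z hz x => T.inv φ φ.2 z ((AdelicGroupData.gl n K).center'_le_quotientSubgroup hz) x
  have key := integral_descend_lieDeriv_mul_conj_cuspFormsGL_eq_neg (μ := μ) hn X hΦinv hΦc hΦs hΦm hΦXc hΦXm hφ hφA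
  -- identify the four functions on the quotient
  have e1 : T.form' (T.lieDerivU X Φ) =
      (AdelicGroupData.gl n K).descend (lieDeriv (AutomorphyDatum.gl n K hcpt).ofArch X (mulChar (detTwist n T.χ) (Φ : _ → ℂ)))
        (lieDeriv_apply_mul_of_forall_apply_mul (AutomorphyDatum.gl n K hcpt) hΦinv X) :=
    invQuot_injective (by rw [invQuot_form', AdelicGroupData.invQuot_descend, coe_lieDerivU, hderΦ])
  have e2 : T.form φ = (AdelicGroupData.gl n K).descend (mulChar (detTwist n T.χ) (φ : _ → ℂ))
      ((AdelicGroupData.gl n K).leftInvariant_quotientSubgroup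
        (isLeftInvariant_of_mem_automorphicForms (cuspFormsGL_le_automorphicForms n K hcpt hφ)) hφA) :=
    invQuot_injective (by rw [invQuot_form, AdelicGroupData.invQuot_descend])
  have e3 : T.form (π.lieDerivW X φ) =
      (AdelicGroupData.gl n K).descend (lieDeriv (AutomorphyDatum.gl n K hcpt).ofArch X (mulChar (detTwist n T.χ) (φ : _ → ℂ)))
        ((AdelicGroupData.gl n K).leftInvariant_quotientSubgroup
          (isLeftInvariant_of_mem_automorphicForms (cuspFormsGL_le_automorphicForms n K hcpt
            ((isStableSubmodule_cuspFormsGL hcpt).lie_stable X _ hφ)))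
          (lieDeriv_apply_center'_mul hφA X)) :=
    invQuot_injective (by rw [AdelicGroupData.invQuot_descend, ← invQuot_form, hderφ])
  rw [← e1, ← e2, ← e3] at key
  -- conjugate
  have c1 : T.pairing μ (T.umgLieRep X Φ) φ = conj (∫ q, T.form' (T.lieDerivU X Φ) q * conj (T.form φ q) ∂μ) := by
    rw [pairing, ← integral_conj]
    refine integral_congr_ae (Filter.Eventually.of_forall fun q => ?_)
    simp only [map_mul, Complex.conj_conj, mul_comm, umgLieRep_apply]
  have c2 : T.pairing μ Φ (π.lieDerivW X φ) = conj (∫ q, T.form' Φ q * conj (T.form (π.lieDerivW X φ) q) ∂μ) := by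
    rw [pairing, ← integral_conj]
    refine integral_congr_ae (Filter.Eventually.of_forall fun q => ?_)
    simp only [map_mul, Complex.conj_conj]
  rw [c1, c2, key, map_neg]
  rfl

end UnitaryTwist

end AutomorphicRepData

end Literature.NumberTheory.Automorphic

end
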